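import Literature.NumberTheory.EllipticCurves.NonsplitNodeConductor
import Literature.NumberTheory.EllipticCurves.BSDConductorSingularProofs
import HarnessLib

/-!
# The conductor schemas of bsd.S15 / C15 fail at a non-split node: `y² = x³ + 3x²` over `ℚ`

Sibling proof file of `BSDConductor` and `BSDConductorSingularProofs`.  The named facts

* `Literature.NumberTheory.EllipticCurves.conductor_eq_conductorOf_mul W ℓ` (bsd.S15 (d), ideal form),
* `Literature.NumberTheory.EllipticCurves.conductorNorm_eq_artinConductorNat W ℓ` (numerical form),
* `Literature.NumberTheory.EllipticCurves.conductorExponent_eq_artinConductorExponent W ℓ` (exponentwise),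
* `WeierstrassCurve.artinConductor_tate_eq_conductor W ℓ`,
  `WeierstrassCurve.artinConductorExponent_tate_eq_conductorExponent W ℓ`,
  `WeierstrassCurve.conductorNatOf_geomPoints_eq_conductorNorm W ℓ` (their C15 sources, `HasseWeilAbelian`)

are `Prop`-valued schemas over **all** `W : WeierstrassCurve ℚ` (the D-0014 sweep dropped the
section instance `[W.IsElliptic]`), whereas the printed statements (Silverman, *ATAEC*, §IV.10,
Definition p. 358 and Definition of `𝔣(E/K)` p. 364, Thm. 10.2, Ogg's formula 11.1; Serre–Tate
1968, §2.1) concern elliptic curves.  `BSDConductorSingularProofs` showed that at a singular `W`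
they assert `𝔣^{(ℓ)}(V_ℓ(E_ns(ℚ̄))) = 1` (resp. `a_v(V_ℓ(E_ns)) = 0` for all `v ∤ ℓ`).  This file
**refutes all six schemas** at the non-split node `W = nodalCubic 3 : y² = x³ + 3x²` and every
prime `ℓ ≠ 3` (so, with `ℓ = 2`, none of them is a theorem: `not_forall_conductor_eq_conductorOf_mul`),
by computing enough of the Artin conductor of the twisted torus
`V_ℓ(E_ns) ≅ ℚ_ℓ(1) ⊗ χ_{ℚ(√3)}` (Silverman, *AEC*, Prop. III.2.5 and Exercise 3.5).  That
computation is carried out in `NonsplitNodeConductor` (`nodalCubic.conductorOf_three_ne_one`: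
`𝔣^{(ℓ)}(V_ℓ(E_ns)) ⊆ (3) ≠ (1)` for `ℓ ≠ 3`; `one_le_conductorExponentOf_three`: `a_3 ≥ 1`;
`conductorExponentOf_three_eq_zero`; and the curve-side junk values `f_v = 0`, `N = 1` at
`Δ = 0`); here it is only assembled against the six schemas:

* `not_conductor_eq_conductorOf_mul_nodalCubic_three`, `not_forall_conductor_eq_conductorOf_mul`;
* `not_artinConductor_tate_eq_conductor_nodalCubic_three`;
* `not_conductorExponent_eq_artinConductorExponent_nodalCubic_three`,
  `not_artinConductorExponent_tate_eq_conductorExponent_nodalCubic_three`;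
* `not_conductorNorm_eq_artinConductorNat_nodalCubic_three`,
  `not_conductorNatOf_geomPoints_eq_conductorNorm_nodalCubic_three`.

The corrected (elliptic-only) facts `…_of_isElliptic` are untouched: they hold vacuously at
singular `W` and carry the printed content at elliptic `W` (`conductor_eq_conductorOf_mul_iff`).

## References

* J. H. Silverman, *The Arithmetic of Elliptic Curves*, 2nd ed., GTM 106 (2009), Prop. III.2.5
  and Exercise 3.5 (the group `E_ns` of a node; non-split case). [SilvermanAEC2009]
* J. H. Silverman, *Advanced Topics in the Arithmetic of Elliptic Curves*, GTM 151 (1994), §IV.10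
  (Definitions, PDF pp. 358, 364), Thm. 10.2, §IV.11 (11.1). [SilvermanATAEC1994]
* J.-P. Serre, *Local Fields*, GTM 67 (1979), Ch. VI §2 (Artin and Swan conductors).
  [SerreLocalFields1979]

## Design

Theorems only; `noncomputable section`, `open scoped Classical`;
`namespace Literature.NumberTheory.EllipticCurves` (the file's path, next to the schemas).
-/

noncomputable section

open scoped Classical NumberField
open IsDedekindDomain Field

/-! ### The conductor schemas at the non-split node: counterexamples -/

namespace Literature.NumberTheory.EllipticCurves

open WeierstrassCurve WeierstrassCurve.nodalCubic

variable (ℓ : ℕ) [Fact ℓ.Prime]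

/-- A continuity proof `h` for the Galois action on `V_ℓ(E_ns)` of the node `y² = x³ + 3x²`
over `ℚ` (the conductor schemas quantify over such `h`; one exists). [folklore] -/
theorem continuous_rationalTateRepresentation_nodalCubic_three :
    Continuous fun x : absoluteGaloisGroup ℚ × RationalTateModule (geomPoints (nodalCubic (3 : ℚ))) ℓ ↦
      rationalTateRepresentation (absoluteGaloisGroup ℚ) (geomPoints (nodalCubic (3 : ℚ))) ℓ x.1 x.2 :=
  nodalCubic.continuous_rationalTateRepresentation ℓ two_mul_three_ne_zero

/-- **bsd.S15 (d), ideal form: the schema fails at the non-split node.**  For every prime `ℓ ≠ 3`,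
`conductor_eq_conductorOf_mul (nodalCubic 3) ℓ` is false: at the singular equation
`y² = x³ + 3x²` the schema asserts `𝔣^{(ℓ)}(V_ℓ(E_ns(ℚ̄))) = 1`
(`conductor_eq_conductorOf_mul_iff_of_Δ_eq_zero`, `BSDConductorSingularProofs`), whereas
`𝔣^{(ℓ)}(V_ℓ(E_ns)) ⊆ (3)` (`WeierstrassCurve.nodalCubic.conductorOf_three_ne_one`: the twisted
torus `ℚ_ℓ(1) ⊗ χ_{ℚ(√3)}` is ramified at `3`).  So the named fact is mis-stated as a schema over
all Weierstrass equations; its content is the corrected fact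
`conductor_eq_conductorOf_mul_of_isElliptic` (`conductor_eq_conductorOf_mul_iff`).
Silverman, *AEC*, Prop. III.2.5 and Exercise 3.5 (the group `E_ns` of a non-split node), against
*ATAEC* §IV.10 (Definition of the conductor, PDF p. 364: *"Let `E/K` be an elliptic curve"*).
[cite: SilvermanAEC2009, Prop. III.2.5 and Exercise 3.5] [cite: SilvermanATAEC1994, §IV.10 Definition of the conductor (PDF p. 364)] -/
theorem not_conductor_eq_conductorOf_mul_nodalCubic_three (hℓ3 : ℓ ≠ 3) :
    ¬ conductor_eq_conductorOf_mul (nodalCubic (3 : ℚ)) ℓ := by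
  rw [conductor_eq_conductorOf_mul_iff_of_Δ_eq_zero _ ℓ (nodalCubic.Δ_eq 3), not_forall]
  exact ⟨continuous_rationalTateRepresentation_nodalCubic_three ℓ,
    conductorOf_three_ne_one ℓ hℓ3 _⟩

/-- **The schema `conductor_eq_conductorOf_mul` is not a theorem**: it fails for
`W = nodalCubic 3` (`y² = x³ + 3x²`) and `ℓ = 2`.  (Its elliptic instances are the corrected fact
`conductor_eq_conductorOf_mul_of_isElliptic`, Silverman *ATAEC* §IV.10–11.)
[cite: SilvermanAEC2009, Prop. III.2.5 and Exercise 3.5] -/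
theorem not_forall_conductor_eq_conductorOf_mul :
    ¬ ∀ (W : WeierstrassCurve ℚ) (ℓ : ℕ) [Fact ℓ.Prime], conductor_eq_conductorOf_mul W ℓ :=
  fun H ↦ not_conductor_eq_conductorOf_mul_nodalCubic_three 2 (by decide) (H _ 2)

/-- **The C15 ideal schema fails at the non-split node**: for every prime `ℓ ≠ 3`,
`WeierstrassCurve.artinConductor_tate_eq_conductor (nodalCubic 3) ℓ` (`HasseWeilAbelian`) is
false (at `Δ = 0` it coincides with the bsd.S15 ideal schema,
`conductor_eq_conductorOf_mul_iff_artinConductor_tate_eq_conductor_of_Δ_eq_zero`).  Its content is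
the corrected fact `WeierstrassCurve.artinConductor_tate_eq_conductor_of_isElliptic`
(`HasseWeilAbelianArtinConductor`). [cite: SilvermanAEC2009, Prop. III.2.5 and Exercise 3.5] -/
theorem not_artinConductor_tate_eq_conductor_nodalCubic_three (hℓ3 : ℓ ≠ 3) :
    ¬ (nodalCubic (3 : ℚ)).artinConductor_tate_eq_conductor ℓ := by
  rw [← conductor_eq_conductorOf_mul_iff_artinConductor_tate_eq_conductor_of_Δ_eq_zero _ ℓ
    (nodalCubic.Δ_eq 3)]
  exact not_conductor_eq_conductorOf_mul_nodalCubic_three ℓ hℓ3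

/-- **The bsd.S15 exponent schema fails at the non-split node**: for every prime `ℓ ≠ 3`,
`conductorExponent_eq_artinConductorExponent (nodalCubic 3) ℓ` (`BSDConductor`: `f_v = a_v(V_ℓ)`
for all `v ∤ ℓ`) is false at `v = (3)`: `f_3 = 0` (junk, `Δ = 0`) but `a_3(V_ℓ(E_ns)) ≥ 1`.  Its
content at elliptic curves is `WeierstrassCurve.artinConductorExponent_tate_eq_conductorExponent_of_isElliptic`.
[cite: SilvermanAEC2009, Prop. III.2.5 and Exercise 3.5] -/
theorem not_conductorExponent_eq_artinConductorExponent_nodalCubic_three (hℓ3 : ℓ ≠ 3) :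
    ¬ conductorExponent_eq_artinConductorExponent (nodalCubic (3 : ℚ)) ℓ := by
  intro H
  set v₃ : HeightOneSpectrum (𝓞 ℚ) :=
    (Rat.HeightOneSpectrum.primesEquiv (R := 𝓞 ℚ)).symm ⟨3, Nat.prime_three⟩
  have h3mem : (3 : 𝓞 ℚ) ∈ v₃.asIdeal := (natCast_three_mem_iff v₃).mpr rfl
  have hℓv₃ : (ℓ : 𝓞 ℚ) ∉ v₃.asIdeal := natCast_not_mem_of_three_mem ℓ hℓ3 h3mem
  have h := continuous_rationalTateRepresentation_nodalCubic_three ℓ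
  have e := H h v₃ hℓv₃
  rw [(nodalCubic (3 : ℚ)).conductorExponent_eq_zero_of_Δ_eq_zero' (nodalCubic.Δ_eq 3) v₃] at e
  have h1 := one_le_conductorExponentOf_three ℓ hℓ3 h h3mem
  change 1 ≤ (rationalTateGaloisRepOf (geomPoints (nodalCubic (3 : ℚ))) ℓ h).artinConductorExponent v₃
    at h1
  omega

/-- **The C15 exponent schema fails at the non-split node**: for every prime `ℓ ≠ 3`,
`WeierstrassCurve.artinConductorExponent_tate_eq_conductorExponent (nodalCubic 3) ℓ`
(`HasseWeilAbelian`: `a_v(V_ℓ) = f_v` for all `v ∤ ℓ`) is false at `v = (3)`.  Its content at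
elliptic curves is the corrected fact `…_of_isElliptic`. [cite: SilvermanAEC2009, Prop. III.2.5 and Exercise 3.5] -/
theorem not_artinConductorExponent_tate_eq_conductorExponent_nodalCubic_three (hℓ3 : ℓ ≠ 3) :
    ¬ (nodalCubic (3 : ℚ)).artinConductorExponent_tate_eq_conductorExponent ℓ := by
  intro H
  set v₃ : HeightOneSpectrum (𝓞 ℚ) :=
    (Rat.HeightOneSpectrum.primesEquiv (R := 𝓞 ℚ)).symm ⟨3, Nat.prime_three⟩
  have h3mem : (3 : 𝓞 ℚ) ∈ v₃.asIdeal := (natCast_three_mem_iff v₃).mpr rfl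
  have hℓv₃ : (ℓ : 𝓞 ℚ) ∉ v₃.asIdeal := natCast_not_mem_of_three_mem ℓ hℓ3 h3mem
  have h := continuous_rationalTateRepresentation_nodalCubic_three ℓ
  have e := H h v₃ hℓv₃
  rw [(nodalCubic (3 : ℚ)).conductorExponent_eq_zero_of_Δ_eq_zero' (nodalCubic.Δ_eq 3) v₃] at e
  have h1 := one_le_conductorExponentOf_three ℓ hℓ3 h h3mem
  omega

/-- **The bsd.S15 numerical schema fails at the non-split node**: for every prime `ℓ ≠ 3`,
`conductorNorm_eq_artinConductorNat (nodalCubic 3) ℓ` (`BSDConductor`: `N_E = N^{(ℓ)}(V_ℓ)` for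
`ℓ ∤ N_E`) is false: `N = 1` (junk, `Δ = 0`), `ℓ ∤ 1`, but `N^{(ℓ)}(V_ℓ(E_ns)) ≠ 1` since
`𝔣^{(ℓ)} ⊆ (3)`.  Its content at elliptic curves is `conductorNorm_eq_artinConductorNat_of_isElliptic`.
[cite: SilvermanAEC2009, Prop. III.2.5 and Exercise 3.5] -/
theorem not_conductorNorm_eq_artinConductorNat_nodalCubic_three (hℓ3 : ℓ ≠ 3) :
    ¬ conductorNorm_eq_artinConductorNat (nodalCubic (3 : ℚ)) ℓ := by
  intro H
  have hprime : ℓ.Prime := Fact.out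
  have hN : (nodalCubic (3 : ℚ)).conductorNorm ℤ = 1 :=
    (nodalCubic (3 : ℚ)).conductorNorm_eq_one_of_Δ_eq_zero' ℤ (nodalCubic.Δ_eq 3)
  have h := continuous_rationalTateRepresentation_nodalCubic_three ℓ
  have e := H h (by rw [hN]; exact hprime.not_dvd_one)
  rw [hN] at e
  unfold conductorNatOf at e
  exact conductorOf_three_ne_one ℓ hℓ3 h
    ((Ideal.absNorm_eq_one_iff.mp e.symm).trans Ideal.one_eq_top.symm)

/-- **The C15 numerical schema fails at the non-split node**: for every prime `ℓ ≠ 3`,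
`WeierstrassCurve.conductorNatOf_geomPoints_eq_conductorNorm (nodalCubic 3) ℓ` (`HasseWeilAbelian`)
is false.  Its content at elliptic curves is the corrected fact `…_of_isElliptic`.
[cite: SilvermanAEC2009, Prop. III.2.5 and Exercise 3.5] -/
theorem not_conductorNatOf_geomPoints_eq_conductorNorm_nodalCubic_three (hℓ3 : ℓ ≠ 3) :
    ¬ (nodalCubic (3 : ℚ)).conductorNatOf_geomPoints_eq_conductorNorm ℓ := by
  intro H
  have hprime : ℓ.Prime := Fact.out
  have hN : (nodalCubic (3 : ℚ)).conductorNorm ℤ = 1 :=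
    (nodalCubic (3 : ℚ)).conductorNorm_eq_one_of_Δ_eq_zero' ℤ (nodalCubic.Δ_eq 3)
  have h := continuous_rationalTateRepresentation_nodalCubic_three ℓ
  have e := H h (by rw [hN]; exact hprime.not_dvd_one)
  rw [hN] at e
  unfold conductorNatOf at e
  exact conductorOf_three_ne_one ℓ hℓ3 h
    ((Ideal.absNorm_eq_one_iff.mp e).trans Ideal.one_eq_top.symm)

end Literature.NumberTheory.EllipticCurves

end
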